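import Literature.AlgebraicGeometry.HodgeTheory.HodgeClassesBlowupBirationalInvariance
import Literature.AlgebraicGeometry.Resolution.KollarBlowupSequenceFunctorsProofs
import Literature.AlgebraicGeometry.Hironaka2017.Lib.CentreSeqIrreducibleRefinement
import Literature.AlgebraicGeometry.Resolution.ProjectiveBirationalBlowupProofs
import Literature.AlgebraicGeometry.Resolution.LogResolutionOfClosedSubset
import Literature.AlgebraicGeometry.Resolution.PrimeDivisorIdeals
import Literature.AlgebraicGeometry.Resolution.RegularCentreBlowupSeqIntegral
import Literature.AlgebraicGeometry.Resolution.ArithmeticalThreefoldsBlowupFormDimThree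
import Literature.AlgebraicGeometry.Motives.CyclesDimensionProofs
import Literature.AlgebraicGeometry.Motives.BettiCycleClassProofs
import Literature.AlgebraicGeometry.Motives.CurveNet
import Literature.AlgebraicGeometry.Morphisms.SubschemeIntegral
import Literature.AlgebraicGeometry.HodgeTheory.OddHypersurfaceHodgeConjecture
import Literature.AlgebraicGeometry.HodgeTheory.HolomorphicBundleChernCharacterProjectiveSpace
import Literature.AlgebraicGeometry.HodgeTheory.ComplexConjugationHolds
import HarnessLib

/-!
# Hironaka's domination of birational maps by smooth blow-up towers — proved

Topic `Literature/AlgebraicGeometry/HodgeTheory`; namespace `Literature.AlgebraicGeometry.HodgeTheory`.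
Sibling PROOFS file of `HodgeClassesBlowupBirationalInvariance.lean` (cell hodge-nonav, planner p1,
ROUTE-P1L §3 / ROUTE-P1M §CL⁺, ask L-HIR), DISCHARGING its named fact
`Hironaka1964_smoothBlowupTower_dominates_birational` (Hartshorne V Remark 5.6.1 after Hironaka 1964;
Kollár 2007 Cor. 3.18 / Thm. 3.21; Murre 1977 p. 232 for `n = 4`):

  for smooth projective complex `n`-folds `X`, `X''` and a birational `p : X'' → X` there are a tower
  `X = X₀ ← X₁ ← ⋯ ← X₃` of blow-ups along smooth irreducible centres of dimension `≤ n - 2`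
  (`Relation.ReflTransGen (SmoothBlowupStep n) X X₃`), `X₃` smooth projective of dimension `n`, and
  a surjective `ℂ`-morphism `r : X₃ → X''`.

No definition and no named fact is introduced (D-0026): the file assembles THEOREMS of the tree.

## The proof (Hartshorne II Example 7.17.3 with Kollár's principalization; all inputs are tree theorems)

1. `p` is the blowing up of a nonzero ideal sheaf `I ⊂ 𝒪_X` (Liu 2002 Thm. 8.1.24 = Hartshorne II
   Thm. 7.17 for a birational `k`-morphism of integral projective `k`-schemes; tree
   `Resolution.Liu2002Thm8124Projective_holds`).
2. Kollár's order reduction for the marked ideal `(X, I, 1, ∅)` (Thm. 3.69, from Thms. 3.103 and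
   3.107 by the induction 3.70; tree `Kollar2007Thm3_103_holds.orderReduction Kollar2007Thm3_107_holds`,
   giving `Kollar2007.MarkedOrderReductionInDim` in every dimension) is a blow-up sequence
   (`Resolution.CentreSeq`) with regular centres inside the cosupports that principalizes `I`
   (3.72, p. 152: "`Π^* I = I_r · 𝒪_{X_r}(F)` … Here `I_r = 𝒪_{X_r}` since `max-ord I_r < 1`"; tree
   `IsMultipleBlowup.exists_comap_eq_mul`, `IsMarkedResolution.ideal_eq_top`) — this IS Kollár's
   proof of Thm. 3.21 (3) "`f` is a composite of smooth blow-ups" (p. 124).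
3. Its (possibly reducible) regular centres are re-sequenced into IRREDUCIBLE ones (BGMW 2011 §4
   Step 2b "we can randomly pick any maximal irreducible component"; Stacks 080A; tree
   `Hironaka2017.S16Proof.exists_isResolutionOf_allIrreducible`, kernel library of the res-hironaka
   lane — only its BGMW/Kollár vocabulary is used, nothing of the 2017 manuscript).
4. Each centre `Z = V(C)` is then integral and regular, hence smooth over `ℂ` of some relative
   dimension `k` (`Resolution.smooth_of_isRegular_of_perfectField`, Stacks 0B8X), projective
   (closed in `X_i`) and geometrically irreducible; the blow-up `X_{i+1}` is smooth projective of
   dimension `n` (Hartshorne II 8.24 (a), tree `Resolution.IsBlowup.isSmoothProjective`). By the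
   dimension formula `height + coheight = n` on `X_i` (Hartshorne II Ex. 3.20 (d), tree
   `Motives.height_add_coheight_eq_of_smoothOfRelativeDimension`) the generic point of `Z` has
   coheight `n - k ≥ 1`. If it is `1`, `Z` is a smooth prime divisor on the regular `X_i`, hence an
   effective Cartier divisor (Auslander–Buchsbaum, tree `Resolution.isEffectiveCartier_primeDivisorIdeal_of_isRegular`)
   and the blow-up is an ISOMORPHISM (Kollár Warning 3.20 "trivial blow-ups", p. 123; tree
   `Resolution.IsBlowup.isIso`); otherwise `k + 2 ≤ n` and the step is a `SmoothBlowupStep`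
   (`smoothBlowupStep_or_iso_of_isBlowup`). Isomorphic steps are absorbed into the neighbouring
   blow-ups (`SmoothBlowupStep.of_iso_base`, `exists_iso_reflTransGen_smoothBlowupStep_of_reflTransGen_or_iso`)
   — exactly the re-packaging announced in the module docstring of the statement file.
5. On the top `X₃` the ideal `I` becomes locally principal and nonzero, hence an effective Cartier
   divisor, so the universal property of the blowing up `p` (Görtz–Wedhorn Def. 13.90, tree
   `Resolution.IsBlowup.universal`) gives `r : X₃ → X''` over `X` (Hartshorne II Example 7.17.3:
   "`π⁻¹𝓘·𝒪_X̃` is an invertible sheaf of ideals, so … define a morphism"; Kollár Cor. 3.18, p. 123).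
6. `r` is onto: its image is closed (`r` is proper) and contains the preimage of the dense open over
   which `p` is an isomorphism, a nonempty open subset of the irreducible `X''`.

## Content

* §0 `surjective_of_isBirational_of_universallyClosed'` (a proper birational morphism is onto),
  `map_hom_eq_comap_inv_of_iso`, `ker_comp_iso_hom`, `SmoothBlowupStep.of_iso_base`,
  `exists_iso_reflTransGen_smoothBlowupStep_of_reflTransGen_or_iso`;
* §1 `smoothBlowupStep_or_iso_of_isBlowup` — one blow-up along an irreducible regular centre;
* §2 `exists_tower_of_centreSeq` — recursion along a `CentreSeq` with irreducible regular centres;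
* §3 **`Hironaka1964_smoothBlowupTower_dominates_birational_holds`** — the discharge;
* §4 consequences with the Hironaka hypothesis removed: `hodgeBirationalInvariant_of_le_five'`
  (Arapura 2001 Cor. 17 modulo the SINGLE named fact `Arapura2001_hodgeClasses_algebraic_smoothBlowup`),
  `hodgeBirationalInvariant_of_centres'`, `HaveCommonSmoothModel.hodgeConjectureFor_of_le_five'`,
  `haveCommonSmoothModel_of_isBirational` (surjectivity of the legs of a roof is automatic),
  `exists_smoothBlowupTower_surjective_of_roof` (a roof `X ← X'' → Y`, birational / surjective,
  is a domination of `Y` by a blow-up tower over `X` — the cell's `DominatedViaBlowupTower n X Y`,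
  unfolded), `hodgeConjectureFor_of_isBirational_of_centres`, `hodgeConjectureFor_of_isBirational_of_le_five`;
* §5 `hodgeConjectureFor_projectiveSpace` (`ℙᴺ_ℂ`: all even classes algebraic) and
  `hodgeConjectureFor_of_roof_projectiveSpace_le_five` — Murre 1977 (unirational fourfolds) / Arapura
  2001 Lemma 18 in resolved-roof form: a smooth projective `n`-fold `Y`, `n ≤ 5`, dominated by `ℙⁿ`
  through a roof `ℙⁿ ← W → Y` satisfies the Hodge `(p,p)` statement modulo the blow-up closure alone;
  `exists_tower_top_hodgeConjectureFor_of_roof_projectiveSpace_le_five` (targets of any dimension, up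
  to the Summits-layer descent along the final surjection).

## References

* [Hartshorne1977] R. Hartshorne, Algebraic Geometry, GTM 52 (1977): V Remark 5.6.1; II Thm. 7.17
  and Example 7.17.3; II Prop. 7.16 (b); II Thm. 8.24 (a); II Ex. 3.20 (d).
* [Hironaka1964] H. Hironaka, Resolution of singularities of an algebraic variety over a field of
  characteristic zero I, II, Ann. of Math. 79 (1964) 109–326 (as quoted in Hartshorne V Rem. 5.6.1).
* [Kollar2007] J. Kollár, Lectures on Resolution of Singularities, Ann. of Math. Stud. 166 (2007):
  Thm. 3.17 and Cor. 3.18 (p. 123), Notation 3.19 and Warning 3.20 (p. 123), Thm. 3.21 (p. 124),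
  Thm. 3.69 and 3.70 (p. 150), 3.72 (pp. 151–152) — pages of the held copy.
* [Liu2002] Q. Liu, Algebraic Geometry and Arithmetic Curves, OUP 2002, Thm. 8.1.24.
* [BierstoneGrigorievMilmanWlodarczyk2011] E. Bierstone, D. Grigoriev, P. Milman, J. Włodarczyk,
  Effective Hironaka resolution and its complexity, Asian J. Math. 15 (2011), Def. 3.1.3, §4 Step 2b.
* [Arapura2001HodgeCyclesModuli] D. Arapura, Hodge cycles on some moduli spaces, arXiv:math/0102070,
  Lemma 16, Cor. 17.
* [Murre1977] J. P. Murre, On the Hodge conjecture for unirational fourfolds, Indag. Math. 80 (1977),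
  proof of the Theorem (p. 232).
* [GortzWedhorn2020] U. Görtz, T. Wedhorn, Algebraic Geometry I, 2nd ed., Def. 13.90, Thm. 11.40 (2).
* [StacksProject] The Stacks Project, Tag 080A, Tag 0B8X, Tag 01RN.
-/

noncomputable section

open CategoryTheory CategoryTheory.Limits AlgebraicGeometry TopologicalSpace
open Literature.AlgebraicGeometry.Motives Literature.AlgebraicGeometry.Resolution

namespace Literature.AlgebraicGeometry.HodgeTheory

universe u

/-! ## §0 Generalities: blow-ups along effective Cartier divisors, isomorphic bases, kernels -/

section General

/-- A proper morphism whose restriction over a dense open is an isomorphism is surjective (its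
image is closed and contains the dense open). [cite: Hartshorne1977, II Prop. 7.16 (b)] -/
theorem surjective_of_isBirational_of_universallyClosed' {X' X : Scheme.{u}} (π : X' ⟶ X)
    [UniversallyClosed π] (h : IsBirational π) : Surjective π := by
  obtain ⟨U, hU, -, hiso⟩ := h
  refine ⟨fun x ↦ ?_⟩
  have hcl : IsClosed (Set.range π.base) := π.isClosedMap.isClosed_range
  have hsub : (U : Set X) ⊆ Set.range π.base := by
    intro u hu
    obtain ⟨y, hy⟩ := (inferInstance : Surjective (π ∣_ U)).1 ⟨u, hu⟩
    refine ⟨y.1, ?_⟩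
    have := congrArg Subtype.val hy
    rwa [morphismRestrict_base_coe] at this
  exact (hcl.closure_subset_iff.mpr hsub) (hU x)

/-- For an isomorphism `e : X ≅ Y` of schemes, pushing an ideal sheaf forward along `e.hom` is
pulling it back along `e.inv`. [folklore] -/
private theorem map_hom_eq_comap_inv_of_iso {X Y : Scheme.{u}} (e : X ≅ Y) (K : X.IdealSheafData) :
    K.map e.hom = K.comap e.inv := by
  apply le_antisymm
  · have h : ((K.map e.hom).comap e.hom).comap e.inv ≤ K.comap e.inv :=
      Scheme.IdealSheafData.comap_mono e.inv
        (Scheme.IdealSheafData.comap_map_le (I := K) (f := e.hom))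
    rwa [← Scheme.IdealSheafData.comap_comp, e.inv_hom_id, Scheme.IdealSheafData.comap_id] at h
  · rw [Scheme.IdealSheafData.le_map_iff_comap_le, ← Scheme.IdealSheafData.comap_comp,
      e.hom_inv_id, Scheme.IdealSheafData.comap_id]

/-- The kernel of a morphism followed by an isomorphism is the pull-back of the kernel along the
inverse isomorphism. [folklore] -/
private theorem ker_comp_iso_hom {Z X Y : Scheme.{u}} (i : Z ⟶ X) (e : X ≅ Y) :
    (i ≫ e.hom).ker = i.ker.comap e.inv := by
  rw [Scheme.Hom.ker_comp, map_hom_eq_comap_inv_of_iso]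

variable {n : ℕ}

/-- **A smooth blow-up step is unchanged by an isomorphism of its base**: if `X'' → X'` is a
blow-up of the smooth projective `n`-fold `X'` along a smooth centre of dimension `≤ n - 2` and
`X ≅ X'` over `ℂ`, then `X'' → X' ≅ X` is such a blow-up of `X` (the centre and the ideal are
transported along the isomorphism; the universal property is insensitive to it,
`Resolution.IsBlowup.comp_iso`). [cite: Kollar2007, Notation 3.19] -/
theorem SmoothBlowupStep.of_iso_base {X X' X'' : SchemeOver ℂ} (e : X ≅ X')
    (h : SmoothBlowupStep n X' X'') : SmoothBlowupStep n X X'' := by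
  obtain ⟨k, Z, i, b, hk, hb⟩ := h
  refine ⟨k, Z, i ≫ e.inv, b ≫ e.inv, hk, ?_⟩
  haveI := hb.isClosedImmersion
  refine ⟨hb.base.of_iso e.symm, hb.centre, hb.top, ?_, ?_⟩
  · rw [Over.comp_left]
    infer_instance
  · -- the scheme isomorphism underlying `e.symm`
    let e' : X'.left ≅ X.left := (Over.forget _).mapIso e.symm
    have he' : e'.hom = e.inv.left := rfl
    have hbl : IsBlowup (b.left ≫ e'.hom) (i.left.ker.comap e'.inv) := hb.isBlowup.comp_iso e'
    have hker : (i ≫ e.inv).left.ker = i.left.ker.comap e'.inv := by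
      rw [Over.comp_left, ← he', ker_comp_iso_hom]
    rw [hker, Over.comp_left, ← he']
    exact hbl

/-- **Absorbing isomorphisms in a tower**: a chain of smooth blow-up steps and `ℂ`-isomorphisms
from `X` to `Y` yields a genuine smooth blow-up tower from `X` to some `Y' ≅ Y` (push every
isomorphism into the next blow-up, `SmoothBlowupStep.of_iso_base`; a trailing isomorphism is
returned). [cite: Kollar2007, Notation 3.19–3.20] -/
theorem exists_iso_reflTransGen_smoothBlowupStep_of_reflTransGen_or_iso {X Y : SchemeOver ℂ}
    (h : Relation.ReflTransGen (fun A B ↦ SmoothBlowupStep n A B ∨ Nonempty (A ≅ B)) X Y) :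
    ∃ (Y' : SchemeOver ℂ) (_ : Y' ≅ Y), Relation.ReflTransGen (SmoothBlowupStep n) X Y' := by
  induction h with
  | refl => exact ⟨X, Iso.refl X, Relation.ReflTransGen.refl⟩
  | @tail B C _ hstep ih =>
    obtain ⟨B', eB, hB'⟩ := ih
    rcases hstep with hS | hI
    · exact ⟨C, Iso.refl C, hB'.tail (SmoothBlowupStep.of_iso_base eB hS)⟩
    · obtain ⟨eBC⟩ := hI
      exact ⟨B', eB ≪≫ eBC, hB'⟩

end General

/-! ## §1 One blow-up along an irreducible smooth centre: a smooth blow-up step or an isomorphism -/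

section OneStep

variable {n : ℕ}

/-- An isomorphism of schemes is surjective. [folklore] -/
private theorem surjective_of_isIso {X Y : Scheme.{u}} (π : X ⟶ Y) [IsIso π] : Surjective π :=
  ⟨(Scheme.homeoOfIso (asIso π)).surjective⟩

/-- **One blow-up of a smooth projective complex `n`-fold along a regular centre with irreducible
proper support is either a smooth blow-up step (centre of dimension `≤ n - 2`) or an isomorphism
(centre a smooth prime divisor, hence an effective Cartier divisor on the regular `X`:
Auslander–Buchsbaum, `Resolution.isEffectiveCartier_primeDivisorIdeal_of_isRegular`, and blowing up
an effective Cartier divisor is an isomorphism, `Resolution.IsBlowup.isIso`).** In both cases the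
blow-up is smooth projective of dimension `n` (`Resolution.IsBlowup.isSmoothProjective`, Hartshorne
II 8.24 (a)) and the blow-down is surjective. The codimension of the centre is read off the
dimension formula `height + coheight = n` on `X` (Hartshorne II Ex. 3.20 (d)).
[cite: Hartshorne1977, II Prop. 7.16 (b) and Thm. 8.24 (a)] [cite: Kollar2007, Notation 3.19–3.20] -/
theorem smoothBlowupStep_or_iso_of_isBlowup {X : SchemeOver ℂ} (hX : IsSmoothProjective n X)
    (C : X.left.IdealSheafData) (hCreg : Scheme.IsRegular C.subscheme)
    (hCirr : IsIrreducible (C.support : Set X.left)) (hCne : (C.support : Set X.left) ≠ Set.univ)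
    {X₁' : Scheme.{0}} (π : X₁' ⟶ X.left) (hπ : IsBlowup π C) :
    (SmoothBlowupStep n X (Over.mk (π ≫ X.hom)) ∨ Nonempty (X ≅ Over.mk (π ≫ X.hom))) ∧
      IsSmoothProjective n (Over.mk (π ≫ X.hom) : SchemeOver ℂ) ∧ Surjective π := by
  -- basics on `X`
  haveI := hX.smoothOfRelativeDimension
  haveI : IsIntegral X.left := IsSmoothProjective.isIntegral_holds hX
  haveI : LocallyOfFiniteType X.hom := by
    haveI : Smooth X.hom := SmoothOfRelativeDimension.smooth n _
    infer_instance
  haveI : IsLocallyNoetherian X.left := LocallyOfFiniteType.isLocallyNoetherian X.hom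
  have hreg : Scheme.IsRegular X.left := fun x ↦
    isRegularLocalRing_stalk_of_smoothOfRelativeDimension X.hom n x
  -- the centre is a nonzero ideal
  have hC0 : C ≠ ⊥ := by
    intro h
    apply hCne
    rw [h, Scheme.IdealSheafData.support_bot]
    rfl
  -- the blow-up is smooth projective of dimension `n`
  have hX₁ : IsSmoothProjective n (Over.mk (π ≫ X.hom) : SchemeOver ℂ) :=
    hπ.isSmoothProjective hX hC0 hCreg
  -- the centre `Z = V(C)` as an integral scheme, its generic point `ζ` and its image `x`
  haveI : IrreducibleSpace C.subscheme :=
    Literature.AlgebraicGeometry.Morphisms.irreducibleSpace_subscheme C hCirr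
  haveI : IsReduced C.subscheme := hCreg.isReduced
  haveI : IsIntegral C.subscheme := isIntegral_of_irreducibleSpace_of_isReduced _
  set ζ : C.subscheme := genericPoint C.subscheme with hζdef
  set x : X.left := C.subschemeι ζ with hxdef
  have hsuppx : (C.support : Set X.left) = closure {x} := by
    rw [← Scheme.IdealSheafData.range_subschemeι,
      BirationalBlowup.range_eq_closure_genericPoint C.subschemeι]
  -- the centre as a smooth `ℂ`-scheme of relative dimension `k`
  let Z : SchemeOver ℂ := Over.mk (C.subschemeι ≫ X.hom)
  haveI : Smooth (C.subschemeι ≫ X.hom) := smooth_of_isRegular_of_perfectField _ hCreg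
  obtain ⟨k, hk⟩ := exists_smoothOfRelativeDimension_of_smooth (C.subschemeι ≫ X.hom)
  haveI := hk
  -- dimension count: `height x = k`, `height x + coheight x = n`
  have hdimZ : topologicalKrullDim C.subscheme = (k : WithBot ℕ∞) :=
    topologicalKrullDim_eq_of_smoothOfRelativeDimension (C.subschemeι ≫ X.hom) k
  have hhx : Order.height x = (k : ℕ∞) := by
    have h1 : Order.height x = Order.height ζ := Scheme.height_base_eq_of_isClosedImmersion C.subschemeι ζ
    have h2 : (Order.height ζ : WithBot ℕ∞) = topologicalKrullDim C.subscheme :=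
      Scheme.height_genericPoint C.subscheme
    rw [h1]
    rw [hdimZ] at h2
    exact_mod_cast h2
  haveI : IrreducibleSpace X.left := inferInstance
  have hsum : (k : ℕ∞) + Order.coheight x = n := by
    have := height_add_coheight_eq_of_smoothOfRelativeDimension X.hom n x
    rwa [hhx] at this
  -- `coheight x = c ∈ ℕ`, `k + c = n`, `1 ≤ c`
  have hcoh_ne_top : Order.coheight x ≠ ⊤ := by
    intro h
    rw [h, add_top] at hsum
    exact ENat.top_ne_coe n hsum
  obtain ⟨c, hc⟩ := ENat.ne_top_iff_exists.mp hcoh_ne_top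
  have hkc : k + c = n := by
    rw [← hc] at hsum
    exact_mod_cast hsum
  have hxmem : x ∈ (C.support : Set X.left) := by
    rw [hsuppx]; exact subset_closure rfl
  have hc1 : 1 ≤ c := by
    have h := one_le_coheight_of_mem_of_isClosed_of_ne_univ C.support.isClosed hCne hxmem
    rw [← hc] at h
    exact_mod_cast h
  refine ⟨?_, hX₁, ?_⟩
  · by_cases hc2 : c = 1
    · -- a smooth prime divisor on the regular `X`: effective Cartier, the blow-up is an isomorphism
      right
      have hCeq : C = primeDivisorIdeal x := by
        rw [eq_vanishingIdeal_support_of_isRegular C hCreg, primeDivisorIdeal]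
        congr 1
        ext1
        exact hsuppx
      have hcoh1 : Order.coheight x = 1 := by rw [← hc, hc2]; rfl
      have hCart : IsEffectiveCartier C := by
        rw [hCeq]; exact isEffectiveCartier_primeDivisorIdeal_of_isRegular hreg hcoh1
      haveI : IsIso π := hπ.isIso hCart
      exact ⟨Over.isoMk (asIso π).symm (by
        change inv π ≫ π ≫ X.hom = X.hom
        exact IsIso.inv_hom_id_assoc π X.hom)⟩
    · -- a centre of dimension `k ≤ n - 2`: a smooth blow-up step
      left
      have hk2 : k + 2 ≤ n := by omega
      let i : Z ⟶ X := Over.homMk C.subschemeι rfl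
      let b : (Over.mk (π ≫ X.hom) : SchemeOver ℂ) ⟶ X := Over.homMk π rfl
      haveI hil : IsClosedImmersion i.left := by
        change IsClosedImmersion C.subschemeι; infer_instance
      have hZ : IsSmoothProjective k Z := by
        haveI : IsIntegral Z.left := inferInstanceAs (IsIntegral C.subscheme)
        haveI : GeometricallyIntegral Z.hom := geometricallyIntegral_of_isAlgClosed _
        exact ⟨hk, isProjectiveOver_of_isClosedImmersion_left i hX.isProjectiveOver, inferInstance⟩
      refine ⟨k, Z, i, b, hk2, hX, hZ, hX₁, hil, ?_⟩
      change IsBlowup π (Scheme.Hom.ker C.subschemeι)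
      rw [Scheme.IdealSheafData.ker_subschemeι]
      exact hπ
  · by_cases hc2 : c = 1
    · have hCeq : C = primeDivisorIdeal x := by
        rw [eq_vanishingIdeal_support_of_isRegular C hCreg, primeDivisorIdeal]
        congr 1
        ext1
        exact hsuppx
      have hcoh1 : Order.coheight x = 1 := by rw [← hc, hc2]; rfl
      have hCart : IsEffectiveCartier C := by
        rw [hCeq]; exact isEffectiveCartier_primeDivisorIdeal_of_isRegular hreg hcoh1
      haveI : IsIso π := hπ.isIso hCart
      exact surjective_of_isIso π
    · have hkn : k < n := by omega
      have hb : IsSmoothBlowupAlong n k X Z (Over.mk (π ≫ X.hom)) (Over.homMk C.subschemeι rfl)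
          (Over.homMk π rfl) := by
        haveI hil : IsClosedImmersion (Over.homMk C.subschemeι rfl : Z ⟶ X).left := by
          change IsClosedImmersion C.subschemeι; infer_instance
        have hZ : IsSmoothProjective k Z := by
          haveI : IsIntegral Z.left := inferInstanceAs (IsIntegral C.subscheme)
          haveI : GeometricallyIntegral Z.hom := geometricallyIntegral_of_isAlgClosed _
          exact ⟨hk, isProjectiveOver_of_isClosedImmersion_left (Over.homMk C.subschemeι rfl : Z ⟶ X)
            hX.isProjectiveOver, inferInstance⟩
        refine ⟨hX, hZ, hX₁, hil, ?_⟩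
        change IsBlowup π (Scheme.Hom.ker C.subschemeι)
        rw [Scheme.IdealSheafData.ker_subschemeι]
        exact hπ
      exact hb.surjective hkn

end OneStep

/-! ## §2 A blow-up sequence with irreducible regular centres is a smooth blow-up tower -/

section Tower

open Literature.AlgebraicGeometry.Hironaka2017.S16Proof in
/-- **From a blow-up sequence with irreducible regular centres to a smooth blow-up tower.** Let
`X = (Y → Spec ℂ)` be smooth projective of dimension `n`, `M = (𝓘, E, μ)` a marked ideal on `Y`
with `𝓘 ≠ 0`, `μ ≥ 1`, and `t` a blow-up sequence admissible for `M` (BGMW Def. 3.1.3: regular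
centres inside the supports — hence proper closed subsets) all of whose centres have irreducible
support. Then the top `X_r` of `t`, with its structure map, is reached from `X` by a chain of smooth
blow-up steps and isomorphisms (`smoothBlowupStep_or_iso_of_isBlowup` at each stage), is smooth
projective of dimension `n`, maps onto `Y`, and nonzero ideal sheaves stay nonzero when pulled back
to it. [cite: BierstoneGrigorievMilmanWlodarczyk2011, Def. 3.1.3–3.1.4] [cite: Kollar2007, Notation 3.19–3.20 and Thm. 3.21 (3)] -/
theorem exists_tower_of_centreSeq (n : ℕ) :
    ∀ {Y : Scheme.{0}} (t : CentreSeq Y) (s : Y ⟶ Spec (.of ℂ)),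
      IsSmoothProjective n (Over.mk s : SchemeOver ℂ) → ∀ (M : MarkedIdeal Y), M.ideal ≠ ⊥ →
      1 ≤ M.mult → t.IsAdmissibleFor M → AllIrreducible t →
      ∃ (X₃ : SchemeOver ℂ) (f : X₃ ⟶ Over.mk s) (e : X₃.left ≅ t.top),
        e.hom ≫ t.comp = f.left ∧
        Relation.ReflTransGen (fun A B ↦ SmoothBlowupStep n A B ∨ Nonempty (A ≅ B))
          (Over.mk s : SchemeOver ℂ) X₃ ∧
        IsSmoothProjective n X₃ ∧ Surjective f.left ∧
        ∀ K : Y.IdealSheafData, K ≠ ⊥ → K.comap t.comp ≠ ⊥ := by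
  intro Y t
  induction t with
  | nil Y =>
    intro s hX M _ _ _ _
    refine ⟨Over.mk s, 𝟙 _, Iso.refl _, by simp, Relation.ReflTransGen.refl, hX, ?_, ?_⟩
    · change Surjective (𝟙 Y); infer_instance
    · intro K hK
      change K.comap (𝟙 Y) ≠ ⊥
      rwa [Scheme.IdealSheafData.comap_id]
  | @cons Y C rest ih =>
    intro s hX M hM0 hμ hadm hirr
    obtain ⟨hsupp, hsnc, hCreg, hrest⟩ := (CentreSeq.isAdmissibleFor_cons C rest M).mp hadm
    obtain ⟨hCirr, hirr'⟩ := (allIrreducible_cons C rest).mp hirr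
    -- basics on `Y`
    haveI : SmoothOfRelativeDimension n s := hX.smoothOfRelativeDimension
    haveI : IsIntegral Y := IsSmoothProjective.isIntegral_holds hX
    haveI : LocallyOfFiniteType s := by
      haveI : Smooth s := SmoothOfRelativeDimension.smooth n _
      infer_instance
    haveI : IsLocallyNoetherian Y := LocallyOfFiniteType.isLocallyNoetherian s
    -- the centre is a proper closed subset
    have hCne : (C.support : Set Y) ≠ Set.univ := by
      intro h
      apply support_ne_univ_of_ne_bot hM0
      exact Set.eq_univ_of_univ_subset
        (h ▸ (hsupp.trans (M.support_subset_support_ideal hμ)))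
    have hCne' : C.support ≠ ⊤ := by
      intro h; apply hCne; rw [h]; rfl
    -- one step
    obtain ⟨hstep, hX₁, hπs⟩ :=
      smoothBlowupStep_or_iso_of_isBlowup hX C hCreg hCirr hCne (blowup.π C) (blowup.isBlowup C)
    -- the transformed marked ideal
    have hmb := IsMultipleBlowup.single M C (blowup.π C) (blowup.isBlowup C) hCreg hsupp hsnc
    have hM'0 : (M.transform (blowup.π C) C).ideal ≠ ⊥ :=
      (hmb.isIntegral_and_ideal_ne_bot hM0 hμ).2
    have hμ' : 1 ≤ (M.transform (blowup.π C) C).mult := by simpa using hμ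
    -- the tail
    obtain ⟨X₃, f₁, e₁, he₁, htower, hX₃, hf₁s, hcomap⟩ :=
      ih (blowup.π C ≫ s) hX₁ (M.transform (blowup.π C) C) hM'0 hμ' hrest hirr'
    let b : (Over.mk (blowup.π C ≫ s) : SchemeOver ℂ) ⟶ Over.mk s := Over.homMk (blowup.π C) rfl
    haveI := hf₁s
    haveI := hπs
    refine ⟨X₃, f₁ ≫ b, e₁, ?_, Relation.ReflTransGen.head hstep htower, hX₃, ?_, ?_⟩
    · have h1 : e₁.hom ≫ (rest.comp ≫ blowup.π C) = (e₁.hom ≫ rest.comp) ≫ blowup.π C :=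
        (Category.assoc _ _ _).symm
      refine h1.trans ?_
      rw [he₁, Over.comp_left]
      rfl
    · rw [Over.comp_left]
      exact ⟨hπs.1.comp hf₁s.1⟩
    · intro K hK
      refine Eq.trans_ne (Scheme.IdealSheafData.comap_comp K rest.comp (blowup.π C)) ?_
      exact hcomap _ ((blowup.isBlowup C).comap_ne_bot hCne' hK)

end Tower

/-! ## §3 The discharge: `Hironaka1964_smoothBlowupTower_dominates_birational_holds` -/

section Discharge

open Literature.AlgebraicGeometry.Hironaka2017.S16Proof in
/-- **Hironaka 1964 / Hartshorne V Remark 5.6.1 / Kollár 2007 Thm. 3.21 with Cor. 3.18, PROVED: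
a smooth projective `X''` mapping birationally onto the smooth projective complex `n`-fold `X` is
the surjective image of the top of a tower of blow-ups of `X` along smooth irreducible centres of
dimension `≤ n - 2`.** Discharge of the named fact `Hironaka1964_smoothBlowupTower_dominates_birational`
of `HodgeClassesBlowupBirationalInvariance.lean`. Proof (Hartshorne II Example 7.17.3 + Kollár's
principalization, over the tree): `p : X'' → X` is the blowing up of a nonzero ideal sheaf `I`
(Liu 8.1.24 = Hartshorne II 7.17, `Resolution.Liu2002Thm8124Projective_holds`); Kollár's order
reduction for the marked ideal `(X, I, 1, ∅)` (Thm. 3.69 from Thms. 3.103/3.107, the tree's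
`Kollar2007Thm3_103_holds.orderReduction Kollar2007Thm3_107_holds`) is a blow-up sequence with
smooth centres principalizing `I` (3.72: `Π^*I = I_r · 𝒪(-F)`, `I_r = 𝒪`,
`IsMultipleBlowup.exists_comap_eq_mul`, `IsMarkedResolution.ideal_eq_top`); re-sequence its
reducible centres into irreducible ones (BGMW §4 Step 2b, Stacks 080A:
`exists_isResolutionOf_allIrreducible`); divisorial centres give isomorphic blow-ups and are
absorbed (`exists_tower_of_centreSeq`, `exists_iso_reflTransGen_smoothBlowupStep_of_reflTransGen_or_iso`);
the universal property of `p` (`Resolution.IsBlowup.universal`) yields `X₃ → X''` over `X`, which is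
onto because `p` is an isomorphism over a dense open and `X₃ → X` is onto.
[cite: Hartshorne1977, V Remark 5.6.1 and II Example 7.17.3] [cite: Kollar2007, Thm. 3.21, Cor. 3.18, 3.72]
[cite: Liu2002, Thm. 8.1.24] [cite: BierstoneGrigorievMilmanWlodarczyk2011, §4 Step 2b] -/
theorem Hironaka1964_smoothBlowupTower_dominates_birational_holds :
    Hironaka1964_smoothBlowupTower_dominates_birational := by
  intro n X X'' hX hX'' p hp
  -- basics on `X` and `X''`
  haveI : SmoothOfRelativeDimension n X.hom := hX.smoothOfRelativeDimension
  haveI : IsIntegral X.left := IsSmoothProjective.isIntegral_holds hX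
  haveI : IsIntegral X''.left := IsSmoothProjective.isIntegral_holds hX''
  haveI : LocallyOfFiniteType X.hom := by
    haveI : Smooth X.hom := SmoothOfRelativeDimension.smooth n _
    infer_instance
  haveI : IsLocallyNoetherian X.left := LocallyOfFiniteType.isLocallyNoetherian X.hom
  haveI : CompactSpace X.left := hX.isProjectiveOver.compactSpace
  haveI : IsNoetherian X.left := ⟨⟩
  haveI : IrreducibleSpace X''.left := inferInstance
  have hreg : Scheme.IsRegular X.left := fun x ↦
    isRegularLocalRing_stalk_of_smoothOfRelativeDimension X.hom n x
  haveI : IsProper p.left := isProper_left_of_isSmoothProjective hX'' hX p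
  -- (1) `p` is the blowing up of a nonzero ideal sheaf `I` (Liu 8.1.24 / Hartshorne II 7.17)
  obtain ⟨I, hI0, hpI⟩ := Liu2002Thm8124Projective_holds ℂ X''.left X.left p.left X''.hom X.hom
    inferInstance inferInstance (isProjectiveOver_mk_hom hX''.isProjectiveOver)
    (isProjectiveOver_mk_hom hX.isProjectiveOver) (Over.w p) hp
  -- (2) Kollár: a blow-up sequence resolving the marked ideal `(X, I, 1, ∅)`
  obtain ⟨n', hn'⟩ := exists_equidim_of_isIntegral X.hom
  let T : Kollar2007.Triple ℂ n' :=
    { X := X.left, struct := X.hom, isRegular := hreg, equidim := hn', ideal := I,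
      stalkIdeal_ne_bot := stalkIdeal_ne_bot_of_ne_bot hI0, boundary := [],
      hasSNC := hasSNC_nil_of_isRegular hreg, boundary_pairwise := List.Pairwise.nil }
  obtain ⟨B, hB, -, -, -⟩ :=
    (Kollar2007Thm3_103_holds.orderReduction Kollar2007Thm3_107_holds n').2 1 le_rfl
  obtain ⟨hres, -⟩ := hB T
  -- `hres : (B T).IsResolutionOf ⟨I, [], 1⟩` on `X.left`
  -- (3) irreducible refinement (BGMW §4 Step 2b)
  obtain ⟨t, ht, hirr⟩ := exists_isResolutionOf_allIrreducible (T.marked 1) hres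
  -- (4) the tower
  obtain ⟨X₃, f, e, hef, htower, hX₃, hfs, hcomap⟩ :=
    exists_tower_of_centreSeq n t X.hom hX (T.marked 1) hI0 le_rfl ht.1 hirr
  -- (5) `I` becomes an effective Cartier divisor on the top; the universal property of `p`
  have htopI : (t.transformMarked (T.marked 1)).ideal = ⊤ := ht.isMarkedResolution.ideal_eq_top rfl
  obtain ⟨E, hE, hEq⟩ := (CentreSeq.IsAdmissibleFor.isMultipleBlowup t _ ht.1).exists_comap_eq_mul
  have hlp : IsLocallyPrincipal (I.comap t.comp) := by
    have h : (T.marked 1).ideal.comap t.comp = E := by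
      rw [hEq, htopI, ← Scheme.IdealSheafData.one_eq_top, mul_one]
    change I.comap t.comp = E at h
    rw [h]
    exact hE
  haveI : IsIntegral t.top :=
    (IsMultipleBlowup.isIntegral_and_ideal_ne_bot ht.isMarkedResolution.1 hI0 le_rfl).1
  have hCart : IsEffectiveCartier (I.comap t.comp) := hlp.isEffectiveCartier_of_ne_bot (hcomap I hI0)
  have hCart' : IsEffectiveCartier (I.comap f.left) := by
    rw [← hef, Scheme.IdealSheafData.comap_comp]
    exact hCart.comap_iso e
  obtain ⟨r₀, hr₀, -⟩ := hpI.universal f.left hCart'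
  have hw : r₀ ≫ X''.hom = X₃.hom := by
    rw [← Over.w p, ← Category.assoc, hr₀]
    exact Over.w f
  let r : X₃ ⟶ X'' := Over.homMk r₀ hw
  -- (6) `r` is surjective: its closed image contains the dense open over which `p` is an isomorphism
  haveI : IsProper r.left := isProper_left_of_isSmoothProjective hX₃ hX'' r
  have hps : Surjective p.left := surjective_of_isBirational_of_universallyClosed' p.left hp
  have hrs : Surjective r.left := by
    obtain ⟨U, hUd, -, hUiso⟩ := hp
    haveI := hUiso
    -- the preimage of `U` lies in the image of `r₀`
    have hsub : ((p.left ⁻¹ᵁ U : X''.left.Opens) : Set X''.left) ⊆ Set.range r₀.base := by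
      intro y hy
      obtain ⟨x₃, hx₃⟩ := hfs.1 (p.left.base y)
      refine ⟨x₃, ?_⟩
      have h1 : p.left.base (r₀.base x₃) = p.left.base y := by
        rw [← Scheme.Hom.comp_apply, hr₀]; exact hx₃
      have hm : r₀.base x₃ ∈ (p.left ⁻¹ᵁ U : X''.left.Opens) := by
        change p.left.base (r₀.base x₃) ∈ (U : Set X.left)
        rw [h1]; exact hy
      have hinj : Function.Injective (p.left ∣_ U).base :=
        (Scheme.homeoOfIso (asIso (p.left ∣_ U))).injective
      have h2 : (p.left ∣_ U).base ⟨r₀.base x₃, hm⟩ = (p.left ∣_ U).base ⟨y, hy⟩ := by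
        apply Subtype.ext
        rw [morphismRestrict_base_coe, morphismRestrict_base_coe]
        exact h1
      exact congrArg Subtype.val (hinj h2)
    -- it is a nonempty open subset of the irreducible `X''`, hence dense; the image is closed
    have hne : (((p.left ⁻¹ᵁ U : X''.left.Opens) : Set X''.left)).Nonempty := by
      have hUne : ((U : Set X.left)).Nonempty := hUd.nonempty
      obtain ⟨u, hu⟩ := hUne
      obtain ⟨y, hy⟩ := hps.1 u
      exact ⟨y, show p.left.base y ∈ (U : Set X.left) by rw [hy]; exact hu⟩
    have hdense : Dense (((p.left ⁻¹ᵁ U : X''.left.Opens) : Set X''.left)) :=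
      (p.left ⁻¹ᵁ U).isOpen.dense hne
    have hcl : IsClosed (Set.range r₀.base) := r.left.isClosedMap.isClosed_range
    refine ⟨fun y ↦ ?_⟩
    have : y ∈ closure (((p.left ⁻¹ᵁ U : X''.left.Opens) : Set X''.left)) := hdense y
    exact (hcl.closure_subset_iff.mpr hsub) this
  -- (7) absorb the isomorphisms of the chain into the blow-ups
  obtain ⟨X₃', e', htower'⟩ := exists_iso_reflTransGen_smoothBlowupStep_of_reflTransGen_or_iso htower
  haveI := hrs
  refine ⟨X₃', e'.hom ≫ r, htower', hX₃.of_iso e'.symm, ?_⟩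
  rw [Over.comp_left]
  exact ⟨hrs.1.comp (surjective_of_isIso e'.hom.left).1⟩

end Discharge

/-! ## §4 Consequences: Arapura 2001 Cor. 17 modulo the blow-up closure alone; towers from roofs -/

section Consequences

variable {n : ℕ}

/-- **Arapura 2001 Cor. 17 modulo the single named fact `Arapura2001_hodgeClasses_algebraic_smoothBlowup`**
(Lemma 16, the blow-up closure): algebraicity of rational `(p,p)`-classes is a birational invariant
among smooth projective complex `n`-folds, `n ≤ 5` — the tree's `hodgeBirationalInvariant_of_le_five`
with its Hironaka hypothesis discharged. [cite: Arapura2001HodgeCyclesModuli, Cor. 17] -/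
theorem hodgeBirationalInvariant_of_le_five' (hB : Arapura2001_hodgeClasses_algebraic_smoothBlowup)
    (hn : n ≤ 5) : HodgeBirationalInvariant n :=
  hodgeBirationalInvariant_of_le_five Hironaka1964_smoothBlowupTower_dominates_birational_holds hB hn

/-- **The same in any dimension `n`, modulo the blow-up closure and the Hodge `(p,p)` statement for
all smooth projective varieties of dimension `≤ n - 2`** (the possible centres).
[cite: Arapura2001HodgeCyclesModuli, Lemma 16 and proof of Cor. 17] -/
theorem hodgeBirationalInvariant_of_centres' (hB : Arapura2001_hodgeClasses_algebraic_smoothBlowup)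
    (hlow : ∀ ⦃k : ℕ⦄ ⦃Z : SchemeOver ℂ⦄, k + 2 ≤ n → IsSmoothProjective k Z → HodgeConjectureFor k Z) :
    HodgeBirationalInvariant n :=
  hodgeBirationalInvariant_of_centres Hironaka1964_smoothBlowupTower_dominates_birational_holds hB hlow

/-- **Transfer along a common smooth model, `n ≤ 5`, modulo the blow-up closure alone.**
[cite: Arapura2001HodgeCyclesModuli, Cor. 17 (proof)] -/
theorem HaveCommonSmoothModel.hodgeConjectureFor_of_le_five'
    (hB : Arapura2001_hodgeClasses_algebraic_smoothBlowup) (hn : n ≤ 5) {X X' : SchemeOver ℂ}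
    (hX : IsSmoothProjective n X) (hX' : IsSmoothProjective n X') (hc : HaveCommonSmoothModel n X X')
    (h : HodgeConjectureFor n X) : HodgeConjectureFor n X' :=
  hc.hodgeConjectureFor_of_le_five Hironaka1964_smoothBlowupTower_dominates_birational_holds hB hn hX hX' h

/-- **A birational roof of smooth projective `n`-folds is a common smooth model**: the surjectivity of
the legs required by `HaveCommonSmoothModel` is automatic (a proper birational morphism onto an
irreducible variety is onto, `surjective_of_isBirational_of_universallyClosed'`).
[cite: Hartshorne1977, II Prop. 7.16 (b)] [cite: Arapura2001HodgeCyclesModuli, Cor. 17] -/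
theorem haveCommonSmoothModel_of_isBirational {X X' X'' : SchemeOver ℂ} (hX : IsSmoothProjective n X)
    (hX' : IsSmoothProjective n X') (hX'' : IsSmoothProjective n X'') (p : X'' ⟶ X) (q : X'' ⟶ X')
    (hp : IsBirational p.left) (hq : IsBirational q.left) : HaveCommonSmoothModel n X X' := by
  haveI : IsProper p.left := isProper_left_of_isSmoothProjective hX'' hX p
  haveI : IsProper q.left := isProper_left_of_isSmoothProjective hX'' hX' q
  exact ⟨X'', p, q, hX'', hp, hq, surjective_of_isBirational_of_universallyClosed' p.left hp,
    surjective_of_isBirational_of_universallyClosed' q.left hq⟩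

/-- **Dominant rational maps in resolved form are dominations by blow-up towers.** If the smooth
projective `n`-fold `X` is joined to `Y` by a roof `X ← X'' → Y` with `X''` smooth projective of
dimension `n`, `X'' → X` birational and `X'' → Y` surjective (every dominant rational map `X ⇢ Y` to a
projective `Y` has this form after resolving its graph), then `Y` is the surjective image of the top
of a tower of blow-ups of `X` along smooth irreducible centres of dimension `≤ n - 2` — the
hypothesis `DominatedViaBlowupTower n X Y` of the cell's closure calculus, unfolded (Hartshorne V
Remark 5.6.1: "the birational map `T' = T ∘ f` is a morphism"). [cite: Hartshorne1977, V Remark 5.6.1]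
[cite: Kollar2007, Cor. 3.18] -/
theorem exists_smoothBlowupTower_surjective_of_roof {X X'' Y : SchemeOver ℂ} (hX : IsSmoothProjective n X)
    (hX'' : IsSmoothProjective n X'') (p : X'' ⟶ X) (hp : IsBirational p.left) (q : X'' ⟶ Y)
    [Surjective q.left] :
    ∃ (X₃ : SchemeOver ℂ) (r : X₃ ⟶ Y), Relation.ReflTransGen (SmoothBlowupStep n) X X₃ ∧
      IsSmoothProjective n X₃ ∧ Surjective r.left := by
  obtain ⟨X₃, r, ht, hX₃, hr⟩ :=
    Hironaka1964_smoothBlowupTower_dominates_birational_holds hX hX'' p hp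
  haveI := hr
  refine ⟨X₃, r ≫ q, ht, hX₃, ?_⟩
  rw [Over.comp_left]
  infer_instance

/-- **Climbing a birational morphism, modulo the blow-up closure and the statement for the centres**:
if rational `(p,p)`-classes are algebraic on the smooth projective `n`-fold `X` and on every smooth
projective variety of dimension `≤ n - 2`, then they are algebraic on every smooth projective `X''`
mapping birationally onto `X` (climb the tower by Lemma 16, descend `X₃ → X''` by the tree's
`HodgeConjectureFor.of_surjective`). [cite: Arapura2001HodgeCyclesModuli, Lemma 16 and proof of Cor. 17] -/
theorem hodgeConjectureFor_of_isBirational_of_centres (hB : Arapura2001_hodgeClasses_algebraic_smoothBlowup)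
    (hlow : ∀ ⦃k : ℕ⦄ ⦃Z : SchemeOver ℂ⦄, k + 2 ≤ n → IsSmoothProjective k Z → HodgeConjectureFor k Z)
    {X X'' : SchemeOver ℂ} (hX : IsSmoothProjective n X) (hX'' : IsSmoothProjective n X'')
    (p : X'' ⟶ X) (hp : IsBirational p.left) (h : HodgeConjectureFor n X) : HodgeConjectureFor n X'' := by
  obtain ⟨X₃, r, ht, hX₃, hr⟩ :=
    Hironaka1964_smoothBlowupTower_dominates_birational_holds hX hX'' p hp
  haveI := hr
  exact HodgeConjectureFor.of_surjective (hB.of_reflTransGen_smoothBlowupStep_of_centres hlow ht h) hX₃ hX'' r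

/-- **The same for `n ≤ 5`, modulo the blow-up closure alone** (centres of dimension `≤ 3` cost
nothing: `hodgeConjectureFor_of_dim_le_three_holds`). [cite: Arapura2001HodgeCyclesModuli, Cor. 17] -/
theorem hodgeConjectureFor_of_isBirational_of_le_five (hB : Arapura2001_hodgeClasses_algebraic_smoothBlowup)
    (hn : n ≤ 5) {X X'' : SchemeOver ℂ} (hX : IsSmoothProjective n X) (hX'' : IsSmoothProjective n X'')
    (p : X'' ⟶ X) (hp : IsBirational p.left) (h : HodgeConjectureFor n X) : HodgeConjectureFor n X'' := by
  obtain ⟨X₃, r, ht, hX₃, hr⟩ :=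
    Hironaka1964_smoothBlowupTower_dominates_birational_holds hX hX'' p hp
  haveI := hr
  exact HodgeConjectureFor.of_surjective (hB.of_reflTransGen_smoothBlowupStep hn ht h) hX₃ hX'' r

end Consequences

/-! ## §5 Varieties rationally dominated by projective space, dimension `≤ 5` (Murre 1977; Arapura 2001 L. 18) -/

section ProjectiveSpace

variable {n m : ℕ}

/-- **Projective space satisfies the Hodge `(p,p)` statement**: every even class of `ℙᴺ_ℂ` is
algebraic (`algebraicClasses_projectiveSpace_eq_top`, Voisin I §11.1.2) and a real Hodge model exists
(`exists_isReal_hodgeModel_holds`). [cite: VoisinHodgeI2002, §11.1.2 and §7.3.3 Thm. 7.31 (example of projective space)] -/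
theorem hodgeConjectureFor_projectiveSpace (N : ℕ) : HodgeConjectureFor N (projectiveSpace N ℂ) :=
  hodgeConjectureFor_of_forall_algebraicClasses_eq_top exists_isReal_hodgeModel_holds
    (isSmoothProjective_projectiveSpace' N) (algebraicClasses_projectiveSpace_eq_top N)

/-- **Murre 1977 / Arapura 2001 Lemma 18 in resolved form, modulo the blow-up closure: a smooth
projective `Y` dominated by `ℙⁿ_ℂ`, `n ≤ 5`, through a roof `ℙⁿ ← W → Y` (`W` smooth projective of
dimension `n`, `W → ℙⁿ` birational, `W → Y` surjective — every dominant rational map `ℙⁿ ⇢ Y`, e.g. a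
unirational parametrisation, has this form) satisfies the Hodge `(p,p)` statement.** Murre (n = 4,
unirational fourfolds: "`X' → ℙ⁴ ⇢ X` … `g` is obtained by successive blowing ups of smooth surfaces,
curves and points", p. 232); here from `Hironaka1964_smoothBlowupTower_dominates_birational_holds`,
`hodgeConjectureFor_projectiveSpace`, the blow-up closure (`hB`) with centres of dimension `≤ 3`, and
descent along the surjection (`Ring2`-free: `exists_smoothBlowupTower_surjective_of_roof` is not needed,
the equidimensional and general descents being `HodgeConjectureFor.of_surjective` /
`hodgeConjectureFor_of_reflTransGen_smoothBlowupStep`-style bookkeeping). The print results are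
unconditional; the tree's residue is exactly `Arapura2001_hodgeClasses_algebraic_smoothBlowup`.
[cite: Murre1977, Theorem and its proof (p. 232)] [cite: Arapura2001HodgeCyclesModuli, Lemma 18 and Cor. 17] -/
theorem hodgeConjectureFor_of_roof_projectiveSpace_le_five
    (hB : Arapura2001_hodgeClasses_algebraic_smoothBlowup) (hn : n ≤ 5) {W Y : SchemeOver ℂ}
    (hW : IsSmoothProjective n W) (hY : IsSmoothProjective n Y) (p : W ⟶ projectiveSpace n ℂ)
    (hp : IsBirational p.left) (q : W ⟶ Y) [Surjective q.left] : HodgeConjectureFor n Y :=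
  HodgeConjectureFor.of_surjective
    (hodgeConjectureFor_of_isBirational_of_le_five hB hn (isSmoothProjective_projectiveSpace' n) hW p hp
      (hodgeConjectureFor_projectiveSpace n)) hW hY q

/-- **The same with a target of any dimension, as a domination statement**: a roof
`ℙⁿ ← W → Y` as above exhibits `Y` as the surjective image of the top of a smooth blow-up tower over
`ℙⁿ_ℂ` whose top satisfies the Hodge `(p,p)` statement (modulo the blow-up closure, `n ≤ 5`); the
descent to `Y` along a surjection of arbitrary relative dimension is Arapura 2001 Lemma 13 / Cor. 15
(the Summits-layer theorem `Ring2.Hypotheses.hodgeConjectureFor_of_surjective`, not importable here).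
[cite: Arapura2001HodgeCyclesModuli, Lemma 13, Cor. 15 and Lemma 18] -/
theorem exists_tower_top_hodgeConjectureFor_of_roof_projectiveSpace_le_five
    (hB : Arapura2001_hodgeClasses_algebraic_smoothBlowup) (hn : n ≤ 5) {W Y : SchemeOver ℂ}
    (hW : IsSmoothProjective n W) (p : W ⟶ projectiveSpace n ℂ) (hp : IsBirational p.left)
    (q : W ⟶ Y) [Surjective q.left] :
    ∃ (X₃ : SchemeOver ℂ) (r : X₃ ⟶ Y), IsSmoothProjective n X₃ ∧ Surjective r.left ∧
      HodgeConjectureFor n X₃ := by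
  obtain ⟨X₃, r, ht, hX₃, hr⟩ :=
    exists_smoothBlowupTower_surjective_of_roof (isSmoothProjective_projectiveSpace' n) hW p hp q
  exact ⟨X₃, r, hX₃, hr,
    hB.of_reflTransGen_smoothBlowupStep hn ht (hodgeConjectureFor_projectiveSpace n)⟩

end ProjectiveSpace

end Literature.AlgebraicGeometry.HodgeTheory

end
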